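/-
HONEST FRAMING: certified error envelopes and provably optimal rounding/accumulation schemes for
low-precision formats under stated cost models; every table by two implementations; no hardware
or vendor claims.
-/
import Summits.Ventures.CertifiedArithmetic.LowPrec.OptChainLabels

/-!
# The labelled chain law (Theorem T9), part 2: double rounding, T8(a) re-derived, the R4 statement

Continuation of `OptChainLabels.lean` (cost model CM-B/chain-labels, OPTIMA.md §B Theorem T9).

*  DOUBLE ROUNDING (`exact_le_doubleRounding`, `doubleRounding_attained`): the "every addition
   double rounded" recursive summation — round the sum to the wide `F(q)`, convert at once to the
   narrow `F(p)`; the model of [MMM13] Martin-Dorel–Melquiond–Muller, BIT 53 (2013) §6, whose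
   Property 6.1 bounds it by `γ'_{n-1} Σ|a_i|` with the double-rounding unit `u' = u_q + u_p` — is the
   labelled chain `q,p,q,p,…`, so for nonnegative grid data `s ≤ (1 + m (u_q + u_p)) · ŝ` EXACTLY
   (`m` additions; linear, no `1/(1 - k u')` blow-up, all `m`, underflow included), and the constant is
   ATTAINED for `q ≥ p + 1` with data in `F(q)` by nearest maps with the tie resolutions
   `TiesDownAtShift` / `TiesEvenAtPow` (IEEE ties-to-even has both when `q ≥ p + 2`).  (With data
   confined to `F(p)` and `q ≥ 2p + 1` double rounding is innocuous — `DoubleRoundingAccumulate.lean` —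
   and the worst case drops to T4's `1 + m u_p`; certificate C21 tabulates both data models.)
*  T8(a) (`exact_le_demotion_sequential`) is the special case `q,…,q,p` (`demotion_of_lchain`).
*  `R4_LabelledChainLaw` / `R4_LabelledChainLaw_holds`: the law in the R4 shape — (a) the bound for
   every precision sequence, (b) attainment for every precision sequence by floats of the step formats,
   (c) attainment of the double-rounding constant for every `q ≥ p + 1` and every `m`.
-/

namespace Summit.Ventures.CertifiedArithmetic.LowPrec.Opt

open Literature.ComputerArithmetic.JeannerodRump2018

/-! ## Double rounding: the chain `q, p, q, p, …` -/

/-- The "every operation double rounded" recursive summation: each addition is rounded into the wide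
format `F(q)` by `flq` and the result converted at once into the narrow `F(p)` by `flp`. -/
def drSteps (q p : ℕ) (flq flp : ℚ → ℚ) : List ℚ → List LStep
  | [] => []
  | y :: ys => ⟨q, flq, y⟩ :: ⟨p, flp, 0⟩ :: drSteps q p flq flp ys

/-- `drSteps` of no summands. -/
@[simp] theorem drSteps_nil (q p : ℕ) (flq flp : ℚ → ℚ) : drSteps q p flq flp [] = [] := rfl
/-- `drSteps` unfolds one summand into an addition step and a conversion step. -/
@[simp] theorem drSteps_cons (q p : ℕ) (flq flp : ℚ → ℚ) (y : ℚ) (ys : List ℚ) :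
    drSteps q p flq flp (y :: ys) = ⟨q, flq, y⟩ :: ⟨p, flp, 0⟩ :: drSteps q p flq flp ys := rfl

/-- The summands of `drSteps … ys` add up to `ys.sum`. -/
theorem xsum_drSteps (q p : ℕ) (flq flp : ℚ → ℚ) :
    ∀ ys : List ℚ, xsum (drSteps q p flq flp ys) = ys.sum
  | [] => by simp
  | y :: ys => by rw [drSteps_cons, xsum_cons, xsum_cons, xsum_drSteps q p flq flp ys, List.sum_cons]; simp

/-- The unit roundoffs of `drSteps … ys` add up to `|ys| · (u_q + u_p)`. -/
theorem usum_drSteps (q p : ℕ) (flq flp : ℚ → ℚ) :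
    ∀ ys : List ℚ, usum (drSteps q p flq flp ys) = (ys.length : ℚ) * (unitRoundoff q + unitRoundoff p)
  | [] => by simp
  | y :: ys => by
      rw [drSteps_cons, usum_cons, usum_cons, usum_drSteps q p flq flp ys, List.length_cons]
      push_cast; ring

/-- Every step of a double-rounding chain with nearest maps and nonnegative grid data is `OK`. -/
theorem drSteps_ok {q p : ℕ} (hq : 1 ≤ q) (hp : 1 ≤ p) {emin : ℤ} {flq flp : ℚ → ℚ}
    (hflq : IsRoundNearest q emin flq) (hflp : IsRoundNearest p emin flp) :
    ∀ ys : List ℚ, (∀ y ∈ ys, 0 ≤ y ∧ IsGrid emin y) → ∀ s ∈ drSteps q p flq flp ys, s.OK emin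
  | [], _, s, hs => by simp at hs
  | y :: ys, hys, s, hs => by
      rw [drSteps_cons, List.mem_cons, List.mem_cons] at hs
      rcases hs with rfl | rfl | hs
      · exact ⟨hq, hflq, (hys y (by simp)).1, (hys y (by simp)).2⟩
      · exact ⟨hp, hflp, le_rfl, isGrid_zero emin⟩
      · exact drSteps_ok hq hp hflq hflp ys (fun z hz => hys z (by simp [hz])) s hs

/-- DOUBLE-ROUNDING LAW (Theorem T9(c), upper bound): every addition rounded to nearest into `F(q)`
and at once to nearest into `F(p)` (any `p, q ≥ 1`, any tie rules), nonnegative grid data: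
`x + Σ y_i ≤ (1 + m (u_q + u_p)) · ŝ` for `m` additions — no cross term `u_p u_q`, linear in `m`. -/
theorem exact_le_doubleRounding {p q : ℕ} (hp : 1 ≤ p) (hq : 1 ≤ q) {emin : ℤ}
    {flq flp : ℚ → ℚ} (hflq : IsRoundNearest q emin flq) (hflp : IsRoundNearest p emin flp)
    (x : ℚ) (ys : List ℚ) (hx0 : 0 ≤ x) (hx : IsGrid emin x)
    (hys : ∀ y ∈ ys, 0 ≤ y ∧ IsGrid emin y) :
    x + ys.sum ≤ (1 + (ys.length : ℚ) * (unitRoundoff q + unitRoundoff p)) *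
      lchainEval x (drSteps q p flq flp ys) := by
  have h := exact_le_lchain (drSteps q p flq flp ys) x hx0 hx (drSteps_ok hq hp hflq hflp ys hys)
  rwa [xsum_drSteps, usum_drSteps] at h

/-- The double-rounding witness summand `u_p 2^e + u_q 2^e = (2^(q-p) + 1)·2^(e-q)` is a float of
`F(q, emin)` (`q ≥ p + 1 ≥ 2`, `e ≥ emin + q`). -/
theorem drWitness_isFloat {p q : ℕ} (hp : 1 ≤ p) (hpq : p + 1 ≤ q) {emin e : ℤ}
    (he : emin + q ≤ e) :
    IsFloat q emin ((2 : ℚ) ^ e * unitRoundoff p + (2 : ℚ) ^ e * unitRoundoff q) := by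
  have h2 : (2 : ℚ) ≠ 0 := by norm_num
  obtain ⟨d, hd⟩ : ∃ d : ℕ, q = p + d := ⟨q - p, by omega⟩
  have hd1 : 1 ≤ d := by omega
  refine ⟨2 ^ d + 1, e - q, ?_, by omega, ?_⟩
  · rw [abs_of_nonneg (by positivity), hd, pow_add]
    have h4 : (2 : ℤ) ≤ 2 ^ p := by
      calc (2 : ℤ) = 2 ^ 1 := by norm_num
        _ ≤ 2 ^ p := pow_le_pow_right₀ (by norm_num) hp
    have h5 : (2 : ℤ) ≤ 2 ^ d := by
      calc (2 : ℤ) = 2 ^ 1 := by norm_num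
        _ ≤ 2 ^ d := pow_le_pow_right₀ (by norm_num) hd1
    nlinarith
  · unfold unitRoundoff
    subst hd
    have hsplit : (2 : ℚ) ^ e = (2 : ℚ) ^ (e - ((p + d : ℕ) : ℤ)) * (2 : ℚ) ^ p * (2 : ℚ) ^ d := by
      rw [← zpow_natCast, ← zpow_natCast, ← zpow_add₀ h2, ← zpow_add₀ h2]
      congr 1; push_cast; ring
    rw [hsplit, pow_add]
    push_cast
    field_simp

/-- THE DOUBLE-ROUNDING WITNESS: from `S = 2^e` add `y = u_p 2^e + u_q 2^e`; the wide rounding meets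
the shifted midpoint `2^e (1+u_p) + u_q 2^e` and resolves it DOWN to `2^e (1+u_p)` (`TiesDownAtShift`),
the narrow conversion meets the binade midpoint `2^e (1+u_p)` and resolves it to `2^e`
(`TiesEvenAtPow`): the running sum never moves and each addition loses exactly `(u_q + u_p) 2^e`. -/
theorem lchainEval_drWitness {p q : ℕ} {emin : ℤ} {flq flp : ℚ → ℚ}
    (hT : TiesDownAtShift p q emin flq) (hE : TiesEvenAtPow p emin flp) {e : ℤ}
    (he : emin + q ≤ e) :
    ∀ m : ℕ, lchainEval ((2 : ℚ) ^ e) (drSteps q p flq flp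
      (List.replicate m ((2 : ℚ) ^ e * unitRoundoff p + (2 : ℚ) ^ e * unitRoundoff q))) = (2 : ℚ) ^ e
  | 0 => by simp
  | m + 1 => by
      rw [List.replicate_succ, drSteps_cons, lchainEval_cons, lchainEval_cons]
      dsimp only
      rw [← add_assoc, hT e he, add_zero, hE e (by omega)]
      exact lchainEval_drWitness hT hE he m

/-- DOUBLE-ROUNDING LAW ATTAINED (Theorem T9(c), sharpness): equality
`2^e + Σ y_i = (1 + m (u_q + u_p)) · ŝ` with `ŝ = 2^e`, for every `m`. -/
theorem doubleRounding_attained {p q : ℕ} {emin : ℤ} {flq flp : ℚ → ℚ}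
    (hT : TiesDownAtShift p q emin flq) (hE : TiesEvenAtPow p emin flp) {e : ℤ}
    (he : emin + q ≤ e) (m : ℕ) :
    let ys := List.replicate m ((2 : ℚ) ^ e * unitRoundoff p + (2 : ℚ) ^ e * unitRoundoff q)
    lchainEval ((2 : ℚ) ^ e) (drSteps q p flq flp ys) = (2 : ℚ) ^ e ∧
    (2 : ℚ) ^ e + ys.sum = (1 + (m : ℚ) * (unitRoundoff q + unitRoundoff p)) *
      lchainEval ((2 : ℚ) ^ e) (drSteps q p flq flp ys) := by
  intro ys
  have hc : lchainEval ((2 : ℚ) ^ e) (drSteps q p flq flp ys) = (2 : ℚ) ^ e :=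
    lchainEval_drWitness hT hE he m
  refine ⟨hc, ?_⟩
  rw [hc]
  simp only [ys, List.sum_replicate, nsmul_eq_mul]
  ring

/-! ## T8(a) is the special case `q, …, q, p` -/

/-- A uniform chain (one format, one map, cf. `chainEval`) is a labelled chain. -/
theorem lchainEval_map_uniform (q : ℕ) (fl : ℚ → ℚ) :
    ∀ (ys : List ℚ) (acc : ℚ),
      lchainEval acc (ys.map fun y => (⟨q, fl, y⟩ : LStep)) = chainEval fl acc ys
  | [], _ => rfl
  | y :: ys, acc => by
      rw [List.map_cons, lchainEval_cons, chainEval_cons]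
      exact lchainEval_map_uniform q fl ys _

/-- Summands of a uniform chain. -/
theorem xsum_map_uniform (q : ℕ) (fl : ℚ → ℚ) :
    ∀ ys : List ℚ, xsum (ys.map fun y => (⟨q, fl, y⟩ : LStep)) = ys.sum
  | [] => by simp
  | y :: ys => by rw [List.map_cons, xsum_cons, List.sum_cons, xsum_map_uniform q fl ys]

/-- Unit roundoffs of a uniform chain: `|ys| · u_q`. -/
theorem usum_map_uniform (q : ℕ) (fl : ℚ → ℚ) :
    ∀ ys : List ℚ, usum (ys.map fun y => (⟨q, fl, y⟩ : LStep)) = (ys.length : ℚ) * unitRoundoff q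
  | [] => by simp
  | y :: ys => by
      rw [List.map_cons, usum_cons, List.length_cons, usum_map_uniform q fl ys]
      push_cast; ring

/-- T8(a) RE-DERIVED: accumulate `m` wide summands in `F(q)` then demote once to `F(p)` is the labelled
chain `q,…,q,p` (last summand `0`), so `exact_le_lchain` gives `x + Σ yᵢ ≤ (1 + u_p + m u_q)·fl_p(ŝ)`
— the statement of `exact_le_demotion_sequential`. -/
theorem demotion_of_lchain {p q : ℕ} (hp : 1 ≤ p) (hq : 1 ≤ q) {emin : ℤ}
    {flq flp : ℚ → ℚ} (hflq : IsRoundNearest q emin flq) (hflp : IsRoundNearest p emin flp)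
    (x : ℚ) (ys : List ℚ) (hx : IsFloat q emin x) (hx0 : 0 ≤ x)
    (hys : ∀ y ∈ ys, IsFloat q emin y ∧ 0 ≤ y) :
    x + ys.sum ≤ (1 + unitRoundoff p + (ys.length : ℚ) * unitRoundoff q) * flp (chainEval flq x ys) := by
  have hok : ∀ s ∈ (ys.map fun y => (⟨q, flq, y⟩ : LStep)) ++ [⟨p, flp, 0⟩], s.OK emin := by
    intro s hs
    rw [List.mem_append, List.mem_map, List.mem_singleton] at hs
    rcases hs with ⟨y, hy, rfl⟩ | rfl
    · exact ⟨hq, hflq, (hys y hy).2, isGrid_of_isFloat (hys y hy).1⟩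
    · exact ⟨hp, hflp, le_rfl, isGrid_zero emin⟩
  have h := exact_le_lchain _ x hx0 (isGrid_of_isFloat hx) hok
  rw [lchainEval_append, lchainEval_map_uniform, xsum_append, usum_append, xsum_map_uniform,
    usum_map_uniform, lchainEval_cons, lchainEval_nil, xsum_cons, xsum_nil, usum_cons, usum_nil] at h
  simp only [add_zero] at h
  linarith

/-! ## The rung -/

/-- R4/T9 (OPTIMA.md §B Theorem T9): THE LABELLED CHAIN LAW.  (a) For every sequence of step
precisions `π_i ≥ 1` (any order: promotions, demotions, conversions = steps with summand `0`), all
nearest maps, every nonnegative start value and summands on the grid `2^emin ℤ`: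
`acc + Σ xᵢ ≤ (1 + Σᵢ u_{πᵢ}) · Sₙ`.  (b) For every precision sequence there are ONE nearest map per
format and nonnegative float data (summand `i` in `F(πᵢ, emin)`, start value a float of every format)
with equality and `Sₙ > 0`.  (c) The double-rounding chain `q,p,…,q,p` (`m` additions, conversions
carry summand `0`) attains `1 + m (u_q + u_p)` with data in `F(q, emin)` whenever `q ≥ p + 1`. -/
def R4_LabelledChainLaw : Prop :=
  (∀ (emin : ℤ) (ss : List LStep) (acc : ℚ),
    (∀ s ∈ ss, 1 ≤ s.prec ∧ IsRoundNearest s.prec emin s.fl ∧ 0 ≤ s.x ∧ IsGrid emin s.x) →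
    0 ≤ acc → IsGrid emin acc →
      acc + (ss.map LStep.x).sum ≤ (1 + (ss.map fun s => unitRoundoff s.prec).sum) * lchainEval acc ss) ∧
  (∀ (emin : ℤ) (ps : List ℕ), (∀ r ∈ ps, 1 ≤ r) →
    ∃ (fl : ℕ → ℚ → ℚ) (acc : ℚ) (ss : List LStep),
      (∀ r, 1 ≤ r → IsRoundNearest r emin (fl r)) ∧ ss.map LStep.prec = ps ∧
      (∀ s ∈ ss, s.fl = fl s.prec ∧ IsFloat s.prec emin s.x ∧ 0 ≤ s.x) ∧
      (∀ r, 1 ≤ r → IsFloat r emin acc) ∧ 0 ≤ acc ∧ 0 < lchainEval acc ss ∧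
      acc + (ss.map LStep.x).sum = (1 + (ps.map unitRoundoff).sum) * lchainEval acc ss) ∧
  (∀ (p q : ℕ), 1 ≤ p → p + 1 ≤ q → ∀ (emin : ℤ) (m : ℕ),
    ∃ (flq flp : ℚ → ℚ) (acc : ℚ) (ys : List ℚ),
      IsRoundNearest q emin flq ∧ IsRoundNearest p emin flp ∧
      IsFloat q emin acc ∧ 0 ≤ acc ∧ (∀ y ∈ ys, IsFloat q emin y ∧ 0 ≤ y) ∧ ys.length = m ∧
      0 < lchainEval acc (drSteps q p flq flp ys) ∧
      acc + ys.sum = (1 + (m : ℚ) * (unitRoundoff q + unitRoundoff p)) *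
        lchainEval acc (drSteps q p flq flp ys))

/-- Proof of `R4_LabelledChainLaw`. -/
theorem R4_LabelledChainLaw_holds : R4_LabelledChainLaw := by
  classical
  refine ⟨fun emin ss acc hss hacc0 haccG => exact_le_lchain ss acc hacc0 haccG hss, ?_, ?_⟩
  · intro emin ps hps
    let fl : ℕ → ℚ → ℚ := fun r =>
      if h : 1 ≤ r then Classical.choose (exists_roundNearest_tiesEven h emin) else id
    have hfl : ∀ r, 1 ≤ r → IsRoundNearest r emin (fl r) ∧ TiesEvenAtPow r emin (fl r) := by
      intro r hr
      simp only [fl, dif_pos hr]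
      exact Classical.choose_spec (exists_roundNearest_tiesEven hr emin)
    let e : ℤ := emin + (ps.sum : ℕ)
    have hre : ∀ r ∈ ps, emin + r ≤ e := by
      intro r hr
      have h1 : r ≤ ps.sum := List.le_sum_of_mem hr
      simp only [e]; omega
    let ss : List LStep := ps.map fun r => ⟨r, fl r, (2 : ℚ) ^ e * unitRoundoff r⟩
    have hmem : ∀ s ∈ ss, s.prec ∈ ps ∧ s.fl = fl s.prec ∧ s.x = (2 : ℚ) ^ e * unitRoundoff s.prec := by
      intro s hs
      simp only [ss, List.mem_map] at hs
      obtain ⟨r, hr, rfl⟩ := hs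
      exact ⟨hr, rfl, rfl⟩
    have hee : emin ≤ e := by simp only [e]; omega
    have h2e : (0 : ℚ) < (2 : ℚ) ^ e := zpow_pos (by norm_num) _
    have hw := lchain_attained_add hee ss
      (fun s hs => ⟨by rw [(hmem s hs).2.1]; exact (hfl s.prec (hps _ (hmem s hs).1)).2,
        (hmem s hs).2.2⟩)
    have hus : (ps.map unitRoundoff).sum = usum ss := by
      simp only [usum, ss, List.map_map, Function.comp_def]
    refine ⟨fl, (2 : ℚ) ^ e, ss, fun r hr => (hfl r hr).1, ?_, fun s hs => ⟨(hmem s hs).2.1, ?_, ?_⟩,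
      fun r hr => PTree.isFloat_two_zpow hr hee, h2e.le, ?_, ?_⟩
    · simp only [ss, List.map_map, Function.comp_def, List.map_id']
    · rw [(hmem s hs).2.2]
      exact isFloat_zpow_mul_unitRoundoff (hps _ (hmem s hs).1) (hre _ (hmem s hs).1)
    · rw [(hmem s hs).2.2]
      exact mul_nonneg (zpow_nonneg (by norm_num) _) (unitRoundoff_nonneg _)
    · rw [hw.1]; exact h2e
    · rw [hus]; exact hw.2
  · intro p q hp hpq emin m
    have hq : 1 ≤ q := by omega
    obtain ⟨flq, hflq, hT⟩ := exists_roundNearest_tiesDownAtShift hp hq hpq emin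
    obtain ⟨flp, hflp, hE⟩ := exists_roundNearest_tiesEven hp emin
    have he : emin + q ≤ emin + q := le_rfl
    obtain ⟨hr, hsum⟩ := doubleRounding_attained hT hE he m
    have h2e : (0 : ℚ) < (2 : ℚ) ^ (emin + (q : ℤ)) := zpow_pos (by norm_num) _
    refine ⟨flq, flp, (2 : ℚ) ^ (emin + (q : ℤ)),
      List.replicate m ((2 : ℚ) ^ (emin + (q : ℤ)) * unitRoundoff p
        + (2 : ℚ) ^ (emin + (q : ℤ)) * unitRoundoff q),
      hflq, hflp, PTree.isFloat_two_zpow hq (by omega), h2e.le, fun y hy => ?_, by simp, ?_, ?_⟩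
    · rw [List.eq_of_mem_replicate hy]
      exact ⟨drWitness_isFloat hp hpq he,
        add_nonneg (mul_nonneg h2e.le (unitRoundoff_nonneg p)) (mul_nonneg h2e.le (unitRoundoff_nonneg q))⟩
    · rw [hr]; exact h2e
    · simpa using hsum

end Summit.Ventures.CertifiedArithmetic.LowPrec.Opt
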